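import Mathlib
import Summits.NavierStokesRegularity.NavierStokesRegularity.Theorems.ScenarioCensusAncient
import Summits.NavierStokesRegularity.NavierStokesRegularity.Theorems.ScenarioCensusAncientSymmetry
import Summits.NavierStokesRegularity.NavierStokesRegularity.Theorems.ScenarioCensusPitchDefectTools
import Summits.NavierStokesRegularity.NavierStokesRegularity.Theorems.ScenarioCensusPitchDefectGauge
import Summits.NavierStokesRegularity.NavierStokesRegularity.Theorems.ScenarioCensusPitchDefectAverage
import Summits.NavierStokesRegularity.NavierStokesRegularity.Theorems.ScenarioCensusPitchDefectDecay
import Summits.NavierStokesRegularity.NavierStokesRegularity.Theorems.ScenarioCensusPitchDefectInvisible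
import Summits.NavierStokesRegularity.NavierStokesRegularity.Theorems.ScenarioCensusPeriodicGauge
import HarnessLib

/-!
# Blow-up scenario census, row A8t via the pitch defect (second proof) and row R8t CLOSED

Cell `pub/ns-census` (director-ns KEY req102, D-0154 (A)), typer seat `ns-census-typer-2` (g5).
Census row **A8t** (`Row_A8t`, `ScenarioCensusAncientSymmetry.lean`: ancient mild solution of
Navier–Stokes on `ℝ³ × (−∞,0)` in the duality-form class, a.e.-measurable slices, HELICALLY
SYMMETRIC with pitch `h ≠ 0` — `u(t, R_θ x + hθ e₃) = R_θ u(t,x)` — and time-Type-I,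
`‖u(t,x)‖ ≤ C/√(−t)`) was OPEN-NO-LINE until census v1.31; it was first closed in the tree by
`row_A8t_excluded` (`ScenarioCensusPeriodicGauge.lean`, p624939: the periodic Oseen gauge — steps of
this seat's `PitchDefect.helicalGauge` — plus the periodic Type-I Liouville stubs of crux
HelicalEndLiouville ⟨14062⟩). This file adds:

* `PitchDefect.helical_typeI_liouville_genuine` — the helical time-Type-I Liouville theorem in the
  GENUINE (Oseen-gauge) class: a Type-I ancient mild field whose slices are helical (pitch `h ≠ 0`)
  about moving vertical axes vanishes identically — a SECOND, independent proof along the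
  sanctioned line «pitch-defect» (no use of the HelicalEndLiouville stubs);
* `PitchDefect.helical_typeI_ancient_slices_axial` — row A8t in its sharp form, by the same route:
  every slice is a.e. an AXIAL constant `β(t) e_z` (the witness `w = (−t)^{−1/2} e₃` of
  `ScenarioCensusHelicalSharp.lean` shows `β ≠ 0` occurs, so this is optimal); `Row_A8t` itself is
  not re-declared (it is `row_A8t_excluded`);
* `row_R8t_excluded : Row_R8t` — the (R)DSS helical time-Type-I cell (the open half of the
  composite census row R8) is EXCLUDED-IN-TREE (`row_R8t_of_row_A8t row_A8t_excluded`).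

Second proof = the line «pitch-defect» (ideator ns-idea-2 g7, critic idea-crit-3 PASS-WITH-PRICE; all
stubs landed by this seat in the reshaped MOVING-AXIS form, `ScenarioCensusPitchDefect*.lean`):
(S1) `helicalGauge` — after a time shift the solution is a.e. the Galilean image of a genuine
Oseen-gauge Type-I field `V` (constant `2C`) whose slices are helical about moving vertical axes,
plus an axial constant; (S2) `typeIAncientMild_gradient_bound` — `‖∇V(τ)‖ ≤ C₁/(−τ)`;
(S3a1) `exists_pitchAverage` — the period average `W` is columnar and `‖V − W‖ ≤ 2π|h|C₁/(−τ)`;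
(S3a2) `columnar_oseenDuhamel_ae_zero` — `B(W,W) = 0`; (S3b) `pitchDecay` — hence
`‖V(τ)‖ ≤ M/(−τ)`, one power better than Type I; so the past shift `V(· − δ)`, `δ = M² + 1`, is a
Type-I ancient mild field with constant `1/2 < 1`, which the LANDED census row A2a
(`row_A2a_excluded`, small-constant Type-I Liouville) kills; (S4) `typeIAncientMild_forwardUniqueness`
propagates `V ≡ 0` to all times; the gauge identity then exhibits `u(t)` as an a.e. constant.

This closes an OPEN-NO-LINE cell of the census; it is a statement about helically symmetric
time-Type-I ANCIENT solutions and proves nothing about the regularity of the Navier–Stokes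
initial-value problem (no summit statement is proved by this seat).
-/

-- the summit and its single problem share the name (D-0017 nested layout)
set_option linter.dupNamespace false

noncomputable section

open MeasureTheory Set Function Filter
open scoped Topology ENNReal NNReal

namespace Summit.NavierStokesRegularity.NavierStokesRegularity.Theorems.ScenarioCensus

open Literature.Analysis Literature.Analysis.FluidPDE
open Summit.NavierStokesRegularity.NavierStokesRegularity.Theorems.ScenarioCensus.PitchDefect

namespace PitchDefect

/-- **The helical time-Type-I Liouville theorem in the genuine class, by the pitch defect.** A
Type-I ancient mild field `V` (Oseen gauge, constant `C'`) on `ℝ³ × (−∞,0)` whose slices are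
helically symmetric with pitch `h ≠ 0` about the moving vertical axes through `A τ` —
`V(τ, R_θ y + (R_θ A(τ) − A(τ)) + hθ e₃) = R_θ V(τ, y)` — vanishes identically. Composition of the
«pitch-defect» stubs (S2) gradient bound, (S3a1) period average with defect `O(|h|/(−τ))`,
(S3a2) Oseen-invisibility of the columnar average, (S3b) the lever `‖V(τ)‖ ≤ M/(−τ)`, the landed
small-constant Type-I Liouville theorem `row_A2a_excluded` applied to a past time shift, and
(S4) forward uniqueness; independent of `PeriodicGauge.periodic_typeI_liouville_genuine`.
[cite: KochNadirashviliSereginSverak2009, §1 p. 3 and Thm 6.2 (Type I Liouville programme; arXiv:0709.3599)] -/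
theorem helical_typeI_liouville_genuine {h C' : ℝ} (hh : h ≠ 0)
    {V : ℝ → EuclideanSpace ℝ (Fin 3) → EuclideanSpace ℝ (Fin 3)}
    {A : ℝ → EuclideanSpace ℝ (Fin 3)} (hV : IsTypeIAncientMild C' V)
    (hVhel : ∀ τ < 0, ∀ (θ : ℝ) (y : EuclideanSpace ℝ (Fin 3)),
      V τ (rotZ θ y + (rotZ θ (A τ) - A τ + (h * θ) • EuclideanSpace.single 2 (1 : ℝ))) =
        rotZ θ (V τ y)) :
    ∀ τ < 0, ∀ y, V τ y = 0 := by
  -- (S2) the gradient bound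
  obtain ⟨C₁, hC₁⟩ := typeIAncientMild_gradient_bound hV
  -- (S3a1) the period average and the defect
  obtain ⟨W, hWc, hW1, hWbd, hWgrad, hWdiv, hWz, hWrot, hdef⟩ := exists_pitchAverage hh hV hVhel hC₁
  -- (S3a2) Oseen-invisibility of the columnar average
  have hinv := columnar_oseenDuhamel_ae_zero hWc hW1 hWbd hWgrad hWdiv hWz hWrot
  -- (S3b) super-Type-I decay of `V`
  have hC₁0 : 0 ≤ C₁ := by
    have h1 := hC₁ (-1) (by norm_num) 0
    rw [neg_neg, div_one] at h1
    exact (norm_nonneg _).trans h1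
  have hD0 : 0 ≤ 2 * Real.pi * |h| * C₁ := by positivity
  have hdecay := pitchDecay hD0 hV hWc hWbd (fun τ hτ y => hdef τ hτ y) hinv
  set M : ℝ := 4 * oseenSliceConst (EuclideanSpace ℝ (Fin 3)) * C' * (2 * Real.pi * |h| * C₁)
    with hM_def
  have hM0 : 0 ≤ M := by
    have h1 := hdecay (-1) (by norm_num) 0
    rw [neg_neg, div_one] at h1
    exact (norm_nonneg _).trans h1
  -- the past shift by `δ = M² + 1` has Type-I constant `1/2`
  set δ : ℝ := M ^ 2 + 1 with hδ_def
  have hδ : 0 < δ := by positivity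
  have hsqδ : 0 < Real.sqrt δ := Real.sqrt_pos.2 hδ
  have hMδ : M ≤ Real.sqrt δ := by
    rw [Real.le_sqrt hM0 hδ.le, hδ_def]; linarith
  set Vδ : ℝ → EuclideanSpace ℝ (Fin 3) → EuclideanSpace ℝ (Fin 3) := fun s => V (s - δ) with hVδ_def
  have hVδC : IsTypeIAncientMild C' Vδ := hV.comp_sub_right hδ.le
  have hVδ : IsTypeIAncientMild (1 / 2) Vδ := by
    refine ⟨hVδC.1, hVδC.2.1, hVδC.2.2.1, fun s hs x => ?_⟩
    have hs' : s - δ < 0 := by linarith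
    have key := hdecay (s - δ) hs' x
    have hsq : 0 < Real.sqrt (-s) := Real.sqrt_pos.2 (by linarith)
    -- `δ - s ≥ 2 √δ √(-s)`
    have hprod : 2 * (Real.sqrt δ * Real.sqrt (-s)) ≤ -(s - δ) := by
      nlinarith [Real.sq_sqrt hδ.le, Real.sq_sqrt (show (0 : ℝ) ≤ -s by linarith),
        sq_nonneg (Real.sqrt δ - Real.sqrt (-s))]
    calc ‖Vδ s x‖ = ‖V (s - δ) x‖ := rfl
      _ ≤ M / (-(s - δ)) := key
      _ ≤ M / (2 * (Real.sqrt δ * Real.sqrt (-s))) :=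
          div_le_div_of_nonneg_left hM0 (by positivity) hprod
      _ = (M / (2 * Real.sqrt δ)) / Real.sqrt (-s) := by
          field_simp
      _ ≤ (1 / 2) / Real.sqrt (-s) := by
          refine div_le_div_of_nonneg_right ?_ hsq.le
          rw [div_le_iff₀ (by positivity)]
          linarith
  -- the landed census row A2a (small-constant Type-I Liouville), BY NAME
  have hzero : ∀ s < 0, ∀ x, Vδ s x = 0 := row_A2a_excluded (1 / 2) (by norm_num) Vδ hVδ
  have hVT : ∀ τ < -δ, ∀ x, V τ x = 0 := fun τ hτ x => by
    have h1 := hzero (τ + δ) (by linarith) x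
    simpa only [hVδ_def, add_sub_cancel_right] using h1
  -- (S4) forward uniqueness: `V ≡ 0`
  exact typeIAncientMild_forwardUniqueness hV hVT

/-- **Census row A8t in its sharp form, by the pitch defect** (second, independent proof of the
helical time-Type-I ancient Liouville theorem; `Row_A8t` itself is `row_A8t_excluded` of
`ScenarioCensusPeriodicGauge.lean`). Every helically symmetric (pitch `h ≠ 0`) ancient mild
solution of Navier–Stokes on `ℝ³ × (−∞,0)` (duality form, a.e.-measurable slices) with the
time-Type-I rate `‖u(t,x)‖ ≤ C/√(−t)` has slices that are a.e. AXIAL constants `β(t) e_z`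
(`β ≠ 0` occurs: `row_R8t_witness`, `ScenarioCensusHelicalSharp.lean`). Proof: (S1) `helicalGauge`
at `t₁ = t/2`, then `helical_typeI_liouville_genuine` kills the genuine part.
[cite: KochNadirashviliSereginSverak2009, §1 p. 3 and Thm 6.2 (Type I Liouville programme; arXiv:0709.3599)] -/
theorem helical_typeI_ancient_slices_axial :
    ∀ h : ℝ, h ≠ 0 → ∀ u : ℝ → EuclideanSpace ℝ (Fin 3) → EuclideanSpace ℝ (Fin 3),
      FluidPDE.IsAncientMildSolution 1 u → (∀ t < 0, AEStronglyMeasurable (u t) volume) →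
        (∀ t < 0, ∀ (θ : ℝ) (x : EuclideanSpace ℝ (Fin 3)),
            u t (FluidPDE.rotZ θ x + (h * θ) • EuclideanSpace.single 2 (1 : ℝ)) =
              FluidPDE.rotZ θ (u t x)) →
          (∃ C : ℝ, FluidPDE.HasTypeITimeDecay C u) →
            ∀ t < 0, ∃ β : ℝ, u t =ᵐ[volume] fun _ => β • FluidPDE.eZ := by
  intro h hh u hu hmeas hhel hdec t ht
  obtain ⟨C, hC⟩ := hdec
  -- (S1) the helical Oseen gauge at `t₁ = t/2`
  obtain ⟨V, A, γ, hV, -, hVhel, hrep⟩ := helicalGauge hu hmeas hhel hC (t₁ := t / 2) (by linarith)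
  have hV0 : ∀ τ < 0, ∀ x, V τ x = 0 := helical_typeI_liouville_genuine hh hV hVhel
  -- the gauge identity at `τ = t/2`
  refine ⟨γ (t / 2), ?_⟩
  have hrep' := hrep (t / 2) (by linarith)
  rw [show t / 2 + t / 2 = t by ring] at hrep'
  filter_upwards [hrep'] with x hx
  rw [hx, hV0 (t / 2) (by linarith), zero_add]
  rfl

end PitchDefect

/-- **Census row R8t is EXCLUDED-IN-TREE**: the helical (R)DSS time-Type-I ancient cell (open half
of the composite row R8) follows from A8t (`row_A8t_excluded`, `ScenarioCensusPeriodicGauge.lean`)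
by `row_R8t_of_row_A8t` (the DSS structure is carried, not used). [folklore] -/
theorem row_R8t_excluded : Row_R8t := row_R8t_of_row_A8t row_A8t_excluded

end Summit.NavierStokesRegularity.NavierStokesRegularity.Theorems.ScenarioCensus

end
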